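import Summits.ResolutionOfSingularities.ResolutionOfSingularities.Theorems.FrobeniusLadderFInjectiveMacaulayficationRegularBlowupModelDim2
import Summits.ResolutionOfSingularities.ResolutionOfSingularities.Theorems.FrobeniusLadderFInjectiveMacaulayficationFiniteModificationOfBlowupHolds
import HarnessLib

/-!
# A REGULAR BLOW-UP MODEL of a NORMAL surface with CENTRE SUPPORTED IN THE SINGULAR LOCUS (modulo Lipman 1978 only) — the engine of
# the T-line rung T2 (crux `FInjectiveMacaulayfication` stmt-ResolutionOfSingularities-15315, chain w45a; res-L1-w45a-plan-1 R13.46 (2);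
# statement owner res-L1-w45a-strat-1 `H4LocRepairSig.lean` v1.4 §9′ R-T2; prover res-L1-w45a-stub-4)

[OURS · L1 W4.5a] Support file (`--supports stmt-ResolutionOfSingularities-15315 --as helper`); NOT a statement of any manuscript;
no definitions, no named fact introduced (Lipman 1978 = the tree's named fact `Lipman1978SequenceFinite`, BY NAME; S-V is the THEOREM
`FiniteModificationOfBlowup.finiteModificationOfBlowupIsBlowup_holds` of res-L1-w45a-stub-7); AI-written (AI review is weaker than
expert review).

Same engine as `RegularBlowupModelDim2` (W2), with SUPPORT TRACKING instead of the twist: over a NORMAL surface `X₁ = S₀.X` every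
centre of Lipman's tower «blow up the reduced singular locus, normalise» lies over the closed set `T := X₁ ∖ Reg X₁`:

* `exists_isBlowup_step_supported` — THE LINK: if `ρ : S.X → X₁` is a blowing up along `Q` with `supp Q ⊆ T`, then `Sing S.X ⊆ ρ⁻¹T`
  (off `ρ⁻¹ supp Q ⊇ …` the blow-up is a stalk isomorphism onto REGULAR points), so the composite with `Bl_{Sing} S.X → S.X` is a
  blowing up along a centre supported in `T` (Temkin/Stacks 080B, `IsBlowup.exists_isBlowup_comp_supported`), and so is the composite
  with the normalisation (S-V: the normalisation is a stalk isomorphism off the composite centre because every local ring of `X₁` is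
  integrally closed; `supp J = supp J₀`).
* `exists_regular_isBlowup_supported_of_iterate` — tower induction on `n`, generalising `(S, ρ, Q)`.
* `exists_regular_isBlowup_supported_of_lipman` — for every normal surface `S₀` over a field: a REGULAR `Y`, `π : Y → S₀.X`, and
  `J ≠ ⊥` with `IsBlowup π J` and `supp J ⊆ S₀.X ∖ Reg S₀.X` (a finite set of closed points).

[folklore assembly; cite: Liu2002, Thm. 8.3.44 (PDF p. 427); StacksProject, Tags 080B, 02OS; Temkin2008, Lemma 2.1.4]
-/

-- single-problem summit: the doubled namespace component is forced
set_option linter.dupNamespace false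

noncomputable section

open AlgebraicGeometry CategoryTheory Literature.AlgebraicGeometry.Resolution TopologicalSpace

namespace Summit.ResolutionOfSingularities.ResolutionOfSingularities.Theorems.FInjectiveMacaulayfication.RegularBlowupModelSupported

open Summit.ResolutionOfSingularities.ResolutionOfSingularities.Theorems.FInjectiveMacaulayfication
open Summit.ResolutionOfSingularities.ResolutionOfSingularities.Theorems.FInjectiveMacaulayfication.RegularBlowupModelDim2

/-- **THE LINK with support tracking.** `X₁` integral Noetherian with all local rings integrally closed, `T ⊇ X₁ ∖ Reg X₁`
(i.e. `X₁` regular off `T`), `S` a normal surface, `ρ : S.X → X₁` a blowing up along `Q` with `supp Q ⊆ T`. Then `S.stepπ ≫ ρ` is a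
blowing up along a non-zero ideal sheaf supported in `T`. [folklore assembly] -/
theorem exists_isBlowup_step_supported {k : Type} [Field k] (S : NormalSurface k) (X₁ : Scheme.{0}) [IsIntegral X₁] [IsNoetherian X₁]
    (hnor : ∀ y : X₁, IsIntegrallyClosed (X₁.presheaf.stalk y)) (T : Set X₁) (hreg : ∀ y : X₁, y ∉ T → y ∈ Scheme.regularLocus X₁)
    (ρ : S.X ⟶ X₁) (Q : X₁.IdealSheafData) (hρ : IsBlowup ρ Q) (hQT : (Q.support : Set X₁) ⊆ T) :
    ∃ Q' : X₁.IdealSheafData, Q' ≠ ⊥ ∧ IsBlowup (S.stepπ ≫ ρ) Q' ∧ (Q'.support : Set X₁) ⊆ T := by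
  have hV : FCForallExistsDimLe2.FiniteModificationOfBlowupIsBlowup :=
    FiniteModificationOfBlowup.finiteModificationOfBlowupIsBlowup_holds
  have hb : IsBlowup (singBlowup.π S.X S.hom) (singularLocusIdeal S.X S.hom) := blowup.isBlowup _
  -- `Sing S.X ⊆ ρ⁻¹ T`: off `ρ⁻¹ T` the blow-up is a stalk isomorphism onto a regular point
  have hST : ((singularLocusIdeal S.X S.hom).support : Set S.X) ⊆ ρ.base ⁻¹' T := by
    intro y hy
    rw [coe_support_singularLocusIdeal] at hy
    by_contra hyT
    have hyQ : ρ.base y ∉ (Q.support : Set X₁) := fun h => hyT (hQT h)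
    haveI := isIso_stalkMap_of_isBlowup_of_not_mem hρ y hyQ
    haveI : IsRegularLocalRing (X₁.presheaf.stalk (ρ.base y)) := (Scheme.mem_regularLocus _).mp (hreg _ hyT)
    exact hy ((Scheme.mem_regularLocus y).mpr
      (IsRegularLocalRing.of_ringEquiv (asIso (ρ.stalkMap y)).commRingCatIsoToRingEquiv))
  obtain ⟨Q₀, hQ₀, hQ₀T⟩ := IsBlowup.exists_isBlowup_comp_supported ρ Q (singBlowup.π S.X S.hom)
    (singularLocusIdeal S.X S.hom) T hρ hQT hb hST
  have hne : Q₀ ≠ ⊥ := ne_bot_of_isBlowup hQ₀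
  -- `X' = Bl_{Sing} S.X` is normal over the complement of `supp Q₀`
  set c : singBlowup S.X S.hom ⟶ X₁ := singBlowup.π S.X S.hom ≫ ρ with hc
  let V : (singBlowup S.X S.hom).Opens := c ⁻¹ᵁ ⟨(Q₀.support : Set X₁)ᶜ, Q₀.support.isClosed.isOpen_compl⟩
  have hVn : ∀ y ∈ V, IsIntegrallyClosed ((singBlowup S.X S.hom).presheaf.stalk y) := by
    intro y hy
    have hy' : c.base y ∉ (Q₀.support : Set X₁) := hy
    haveI := isIso_stalkMap_of_isBlowup_of_not_mem hQ₀ y hy'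
    haveI := hnor (c.base y)
    exact IsIntegrallyClosed.of_equiv (asIso (c.stalkMap y)).commRingCatIsoToRingEquiv
  have hgen : IsIso ((normalizationι (singBlowup S.X S.hom)).stalkMap (genericPoint (normalization (singBlowup S.X S.hom)))) :=
    (isBirational_normalizationι (singBlowup S.X S.hom) (singBlowup.π S.X S.hom ≫ S.hom)).isIso_stalkMap_genericPoint
  haveI : IsIso (normalizationι (singBlowup S.X S.hom) ∣_ V) :=
    isIso_morphismRestrict_of_isIntegralHom_of_normal (normalizationι (singBlowup S.X S.hom)) hgen V hVn
  have hsurj : Function.Surjective (normalizationι (singBlowup S.X S.hom)).base :=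
    surjective_of_universallyClosed_of_isDominant _
  have hiso : ∀ x₃ : normalization (singBlowup S.X S.hom),
      c.base ((normalizationι (singBlowup S.X S.hom)).base x₃) ∉ (Q₀.support : Set X₁) →
      IsIso ((normalizationι (singBlowup S.X S.hom)).stalkMap x₃) :=
    fun x₃ hx₃ => RegularBlowupModelDim2.isIso_stalkMap_of_isIso_morphismRestrict (normalizationι (singBlowup S.X S.hom)) V x₃ hx₃
  obtain ⟨J, hJ, hJsupp, hJbl⟩ := hV X₁ (singBlowup S.X S.hom) (normalization (singBlowup S.X S.hom)) Q₀ c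
    (normalizationι (singBlowup S.X S.hom)) inferInstance inferInstance hne hQ₀ inferInstance inferInstance hsurj hiso
  refine ⟨J, hJ, ?_, by rw [hJsupp]; exact hQ₀T⟩
  have e : S.stepπ ≫ ρ = normalizationι (singBlowup S.X S.hom) ≫ c := by
    rw [hc, ← Category.assoc]
    rfl
  rw [e]
  exact hJbl

/-- **Tower induction with support tracking** (generalising `(S, ρ, Q)`). [folklore assembly] -/
theorem exists_regular_isBlowup_supported_of_iterate {k : Type} [Field k] (X₁ : Scheme.{0}) [IsIntegral X₁] [IsNoetherian X₁]
    (hnor : ∀ y : X₁, IsIntegrallyClosed (X₁.presheaf.stalk y)) (T : Set X₁) (hreg : ∀ y : X₁, y ∉ T → y ∈ Scheme.regularLocus X₁) :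
    ∀ (n : ℕ) (S : NormalSurface k) (ρ : S.X ⟶ X₁) (Q : X₁.IdealSheafData), IsBlowup ρ Q → (Q.support : Set X₁) ⊆ T →
      Scheme.IsRegular (NormalSurface.step^[n] S).X →
      ∃ (Y : Scheme.{0}) (_ : Y ⟶ Spec (.of k)) (π : Y ⟶ X₁) (J : X₁.IdealSheafData),
        J ≠ ⊥ ∧ IsBlowup π J ∧ (J.support : Set X₁) ⊆ T ∧ Scheme.IsRegular Y := by
  intro n
  induction n with
  | zero =>
    intro S ρ Q hρ hQT hregS
    exact ⟨S.X, S.hom, ρ, Q, ne_bot_of_isBlowup hρ, hρ, hQT, hregS⟩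
  | succ n ih =>
    intro S ρ Q hρ hQT hregS
    rw [Function.iterate_succ_apply] at hregS
    obtain ⟨Q', -, hbl, hQ'T⟩ := exists_isBlowup_step_supported S X₁ hnor T hreg ρ Q hρ hQT
    exact ih S.step (S.stepπ ≫ ρ) Q' hbl hQ'T hregS

/-- **A REGULAR BLOW-UP MODEL OF A NORMAL SURFACE WITH CENTRE OVER THE SINGULAR LOCUS** (modulo Lipman 1978 BY NAME): for every normal
surface `S₀` over a field there are a regular `k`-scheme `Y`, `π : Y → S₀.X` and a non-zero ideal sheaf `J` supported in
`S₀.X ∖ Reg S₀.X` with `IsBlowup π J`. (Start: the identity blow-up of the unit ideal; then the tower.) [cite: Liu2002, Thm. 8.3.44 (PDF p. 427)] -/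
theorem exists_regular_isBlowup_supported_of_lipman (hL : Lipman1978SequenceFinite.{0}) {k : Type} [Field k] (S₀ : NormalSurface k) :
    ∃ (Y : Scheme.{0}) (_ : Y ⟶ Spec (.of k)) (π : Y ⟶ S₀.X) (J : S₀.X.IdealSheafData),
      J ≠ ⊥ ∧ IsBlowup π J ∧ (J.support : Set S₀.X) ⊆ (Scheme.regularLocus S₀.X)ᶜ ∧ Scheme.IsRegular Y := by
  haveI : IsNoetherian S₀.X := Scheme.isNoetherian_of_finiteType_over_field S₀.hom
  obtain ⟨n, hn⟩ := hL k S₀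
  have h0 : IsBlowup (𝟙 S₀.X) ⊤ := IsBlowup.id isEffectiveCartier_top
  have hT : ((⊤ : S₀.X.IdealSheafData).support : Set S₀.X) ⊆ (Scheme.regularLocus S₀.X)ᶜ := by
    rw [Scheme.IdealSheafData.support_top, TopologicalSpace.Closeds.coe_bot]
    exact Set.empty_subset _
  exact exists_regular_isBlowup_supported_of_iterate S₀.X S₀.normal (Scheme.regularLocus S₀.X)ᶜ
    (fun y hy => not_not.mp hy) n S₀ (𝟙 S₀.X) ⊤ h0 hT hn

end Summit.ResolutionOfSingularities.ResolutionOfSingularities.Theorems.FInjectiveMacaulayfication.RegularBlowupModelSupported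

end
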